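import Summits.HodgeConjecture.CorCM.TwoGroupExtraspecialTable
import Summits.HodgeConjecture.CorCM.GaloisTwentyFourC3SemidirectC8Degenerate
import Summits.HodgeConjecture.CorCM.GaloisIndexTwoAbelianRank
import Summits.HodgeConjecture.CorCM.AbelianTwoPowerClassification
import Summits.HodgeConjecture.CorCM.GaloisSkewSection
import HarnessLib

/-!
# A Galois CM field of degree `32` whose maximal real subfield is multiquadratic is BAD

COR-CM (cell `pub-hodgecm2`), binder seat b04 (gen 36), count-neutral own lane «Galois-CM-type classification».  KERNEL ONLY:
theorems; no definition, no named fact, no `sorry`.  `HC_CM` is neither used nor claimed.  The «Frattini `≤ ⟨c⟩`» branch of the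
ORDER-`32` BASE of the `2`-power classification (A7-JUNCTION gen-36 addendum).

**THEOREM (`exists_simple_degenerate_of_sq_subset`).**  Let `K` be a Galois CM field of degree `32` such that `g² ∈ {1, c}` for every
`g ∈ Gal(K/ℚ)` (`c` = complex conjugation) — equivalently `Φ(Gal(K/ℚ)) ≤ ⟨c⟩`, i.e. the maximal real subfield `K⁺` is a compositum of
real quadratic fields.  Then `K` carries a SIMPLE DEGENERATE abelian `16`-fold with CM by `K`: a primitive degenerate CM type, hence
an exceptional Hodge class (rational, of type `(p,p)`, outside the divisor ring) on some power.  (At degree `16` the analogous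
fields — `C₂⁴`, `C₄×C₂²` (`c` a square), `D₄×C₂` (`c = r²`), `Q₈×C₂` (`c = a²`), `C₄∘D₄` — are all GOOD: gen 17's GOOD16.)

The seven groups of order `32` with `Φ(G) ≤ ⟨c⟩` are treated UNIFORMLY by `CorCM/TwoGroupFrattiniInvolution`: `Gal` abelian
(`C₂⁵`, `C₄×C₂³`) — no cyclic subgroup of index `≤ 2`, BAD by gens 15–16 (`AbelianTwoPowerClassification`); `C_G(x)` abelian of index
`2` for a non-commuting pair `x, y` (`D₄×C₂²`, `Q₈×C₂²`, `(C₄∘D₄)×C₂`) — a central involution `t ≠ c` and a third involution in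
`C_G(x)` feed gen 35's two-cyclic criterion `exists_simple_degenerate_of_index_two_pair` (`4·2 < 16`); `C_G(x)` non-abelian —
`Gal = ⟨x,y⟩ ∘ ⟨x',y'⟩` is EXTRASPECIAL (`2^{1+4}_± = D₄∘D₄, D₄∘Q₈`; census rows #5, #6 of gen 23, skew-type rows never written down
as theorems before), with the table model of `CorCM/TwoGroupExtraspecialTable` on `𝔽₂⁵` and three `(T₀, D)` certificates
(primitive CM set + balanced set, gen 20's `exists_simple_degenerate_of_table_balanced`, found by `scratch/es/escert.py`, checked
by `decide`): `exists_simple_degenerate_extraspecial_dd` (`x² = y² = x'² = y'² = 1`, rank `9`, `|D| = 4`), `…_dq` (`x'² = y'² = c`,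
the group `2^{1+4}_-`, rank `9`, `|D| = 8`), `…_qq` (all squares `c`, rank `13`, `|D| = 4`).

## References

* [Shimura1998] G. Shimura, *Abelian Varieties with Complex Multiplication and Modular Functions*, §6.2 Thm. 3, §8.2 Prop. 26.
* [Kubota1965] T. Kubota, *On the field extension by complex multiplication*, Trans. AMS 118 (1965), §2 and §4 Lemma 2.
* [Gordon1999HodgeAVSurvey] B. B. Gordon, *A survey of the Hodge conjecture for abelian varieties*, Thm. 6.4, §9.3, §9.4.3.
* [Dodson1984] B. Dodson, *The structure of Galois groups of CM-fields*, Trans. AMS 283 (1984), §3.3, §5.3.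
-/

noncomputable section

open CategoryTheory CategoryTheory.Limits NumberField
open scoped BigOperators

namespace Summit.HodgeConjecture.CorCM.GaloisModels

open Literature.NumberTheory.ComplexMultiplication
open Literature.AlgebraicGeometry.Motives (AbelianVariety CMType)
open Literature.AlgebraicGeometry.HodgeTheory
open Literature.AlgebraicGeometry.ComplexMultiplication (IsCMTypeRealisation)
open Literature.AlgebraicGeometry.Pohlmann1968
open Literature.Barriers.HodgeConjecture (divisorClassesSpan)
open Summit.HodgeConjecture.CorCM.GaloisRank
open Summit.HodgeConjecture.CorCM.GaloisModels.FrattiniTwo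

variable {K : Type} [Field K] [NumberField K] [IsCMField K] [IsGalois ℚ K]

/-! ## §1 The extraspecial case: table model and certificates -/

/-- **Certificate format for the extraspecial configuration.**  `[K:ℚ] = 32`; `x, y, x', y' ∈ Gal(K/ℚ)` with `y x = x y c`,
`y' x' = x' y' c`, `x', y'` commuting with `x, y`, squares `c^α, c^β, c^{α'}, c^{β'}` (`c` = complex conjugation); `mul` the law of
`CorCM/TwoGroupExtraspecialTable` with its unit and left-inverse identities; a CM set `T₀ ⊆ 𝔽₂⁵` for `c₀ = (0,0,0,0,1)` with trivial left
stabiliser and a balanced `D` with `c₀ D ≠ D`.  Then `K` carries a simple DEGENERATE CM abelian `16`-fold with an exceptional Hodge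
class on a power. [cite: Shimura1998, §6.2 Thm. 3 and §8.2 Prop. 26] [cite: Gordon1999HodgeAVSurvey, Thm. 6.4 and §9.3] -/
theorem exists_simple_degenerate_of_extraspecial_table (hdeg : Module.finrank ℚ K = 32) (α β α' β' : ZMod 2)
    (x y x' y' : K ≃ₐ[ℚ] K) (hyx : y * x = x * y * (IsCMField.complexConj K).restrictScalars ℚ)
    (hxx : x * x = (IsCMField.complexConj K).restrictScalars ℚ ^ α.val)
    (hyy : y * y = (IsCMField.complexConj K).restrictScalars ℚ ^ β.val)
    (hyx' : y' * x' = x' * y' * (IsCMField.complexConj K).restrictScalars ℚ)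
    (hxx' : x' * x' = (IsCMField.complexConj K).restrictScalars ℚ ^ α'.val)
    (hyy' : y' * y' = (IsCMField.complexConj K).restrictScalars ℚ ^ β'.val)
    (hx'x : x' * x = x * x') (hx'y : x' * y = y * x') (hy'x : y' * x = x * y') (hy'y : y' * y = y * y')
    (mul : ZMod 2 × ZMod 2 × ZMod 2 × ZMod 2 × ZMod 2 → ZMod 2 × ZMod 2 × ZMod 2 × ZMod 2 × ZMod 2 →
      ZMod 2 × ZMod 2 × ZMod 2 × ZMod 2 × ZMod 2)
    (hm : ∀ p q : ZMod 2 × ZMod 2 × ZMod 2 × ZMod 2 × ZMod 2, mul p q =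
      (p.1 + q.1, p.2.1 + q.2.1, p.2.2.1 + q.2.2.1, p.2.2.2.1 + q.2.2.2.1,
        p.2.2.2.2 + q.2.2.2.2 + (p.2.1 * q.1 + α * (p.1 * q.1) + β * (p.2.1 * q.2.1)) +
          (p.2.2.2.1 * q.2.2.1 + α' * (p.2.2.1 * q.2.2.1) + β' * (p.2.2.2.1 * q.2.2.2.1))))
    (ho : ∀ p : ZMod 2 × ZMod 2 × ZMod 2 × ZMod 2 × ZMod 2, mul p (0, 0, 0, 0, 0) = p)
    (hlinv : ∀ p q : ZMod 2 × ZMod 2 × ZMod 2 × ZMod 2 × ZMod 2,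
      mul (p.1, p.2.1, p.2.2.1, p.2.2.2.1, p.2.2.2.2 + p.1 * p.2.1 + α * p.1 + β * p.2.1 + p.2.2.1 * p.2.2.2.1 +
        α' * p.2.2.1 + β' * p.2.2.2.1) (mul p q) = q)
    (T₀ : Finset (ZMod 2 × ZMod 2 × ZMod 2 × ZMod 2 × ZMod 2))
    (hcm : ∀ z : ZMod 2 × ZMod 2 × ZMod 2 × ZMod 2 × ZMod 2, z ∈ T₀ ↔ mul (0, 0, 0, 0, 1) z ∉ T₀)
    (hprim : ∀ v : ZMod 2 × ZMod 2 × ZMod 2 × ZMod 2 × ZMod 2, v ≠ (0, 0, 0, 0, 0) →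
      ∃ w : ZMod 2 × ZMod 2 × ZMod 2 × ZMod 2 × ZMod 2, ¬ (w ∈ T₀ ↔ mul v w ∈ T₀))
    (D : Finset (ZMod 2 × ZMod 2 × ZMod 2 × ZMod 2 × ZMod 2))
    (hbal : ∀ g : ZMod 2 × ZMod 2 × ZMod 2 × ZMod 2 × ZMod 2, 2 * (D.filter fun z => mul z g ∈ T₀).card = D.card)
    (hmov : ∃ z ∈ D, mul (0, 0, 0, 0, 1) z ∉ D) :
    ∃ (Φ : CMType K) (φ : K →+* ℂ) (X : AbelianVariety ℂ) (ι : 𝓞 K →+* End X)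
      (ϑ : K →+* Module.End ℂ (complexBetti X.X 1)),
      IsPrimitive (ℂ ≃+* ℂ) Φ.1 φ ∧ ¬ IsNondegenerate Φ ∧ IsCMTypeRealisation Φ X ι ϑ ∧ X.IsSimple ∧ X.dim = 16 ∧
      ∃ m p : ℕ, ∃ z : complexBetti (⨁ fun _ : Fin m => X).X (2 * p), IsRationalClass z ∧
        IsOfHodgeType (⨁ fun _ : Fin m => X).dim (⨁ fun _ : Fin m => X).X (2 * p) p p z ∧
        z ∉ divisorClassesSpan (⨁ fun _ : Fin m => X).X (⨁ fun _ : Fin m => X).dim p := by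
  classical
  set c := (IsCMField.complexConj K).restrictScalars ℚ with hc
  have hcc : c * c = 1 := model_complexConj_mul_self (MulEquiv.refl (K ≃ₐ[ℚ] K)) (by simp [hc])
  have hc1 : c ≠ 1 := model_complexConj_ne_one (MulEquiv.refl (K ≃ₐ[ℚ] K)) (by simp [hc])
  have hcen : ∀ g : K ≃ₐ[ℚ] K, c * g = g * c := fun g =>
    model_complexConj_comm (MulEquiv.refl (K ≃ₐ[ℚ] K)) (by simp [hc]) g
  have hcard : Nat.card (K ≃ₐ[ℚ] K) = 32 := by
    rw [Nat.card_eq_fintype_card, card_model_eq_finrank (MulEquiv.refl (K ≃ₐ[ℚ] K)), hdeg]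
  obtain ⟨e, he, -, -, -, -, hec, he1⟩ := exists_table_extraspecial hcc hc1 hcen α β α' β' hyx hxx hyy hyx' hxx' hyy'
    hx'x hx'y hy'x hy'y hcard mul hm ho hlinv
  have h := exists_simple_degenerate_of_table_balanced mul e he (0, 0, 0, 0, 1) hec (0, 0, 0, 0, 0) he1 T₀ hcm hprim D hbal hmov
  have h16 : Fintype.card (ZMod 2 × ZMod 2 × ZMod 2 × ZMod 2 × ZMod 2) / 2 = 16 := by simp [Fintype.card_prod, ZMod.card]
  rwa [h16] at h

set_option synthInstance.maxSize 4096 in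
/-- **`Gal(K/ℚ) ⊇ ⟨x,y⟩ ∘ ⟨x',y'⟩` with `x² = y² = x'² = y'² = 1` (`[K:ℚ] = 32`: `Gal ≅ 2^{1+4}_+ = D₄ ∘ D₄`, census row #5) ⟹ a simple DEGENERATE CM abelian `16`-fold** (primitive CM set of rank `9 < 17`, balanced set of size `4`, by `decide`). [cite: Shimura1998, §6.2 Thm. 3 and §8.2 Prop. 26] [cite: Gordon1999HodgeAVSurvey, Thm. 6.4 and §9.3] -/
theorem exists_simple_degenerate_extraspecial_dd (hdeg : Module.finrank ℚ K = 32) (x y x' y' : K ≃ₐ[ℚ] K)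
    (hyx : y * x = x * y * (IsCMField.complexConj K).restrictScalars ℚ) (hxx : x * x = 1) (hyy : y * y = 1)
    (hyx' : y' * x' = x' * y' * (IsCMField.complexConj K).restrictScalars ℚ) (hxx' : x' * x' = 1)
    (hyy' : y' * y' = 1)
    (hx'x : x' * x = x * x') (hx'y : x' * y = y * x') (hy'x : y' * x = x * y') (hy'y : y' * y = y * y') :
    ∃ (Φ : CMType K) (φ : K →+* ℂ) (X : AbelianVariety ℂ) (ι : 𝓞 K →+* End X)
      (ϑ : K →+* Module.End ℂ (complexBetti X.X 1)),
      IsPrimitive (ℂ ≃+* ℂ) Φ.1 φ ∧ ¬ IsNondegenerate Φ ∧ IsCMTypeRealisation Φ X ι ϑ ∧ X.IsSimple ∧ X.dim = 16 ∧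
      ∃ m p : ℕ, ∃ z : complexBetti (⨁ fun _ : Fin m => X).X (2 * p), IsRationalClass z ∧
        IsOfHodgeType (⨁ fun _ : Fin m => X).dim (⨁ fun _ : Fin m => X).X (2 * p) p p z ∧
        z ∉ divisorClassesSpan (⨁ fun _ : Fin m => X).X (⨁ fun _ : Fin m => X).dim p :=
  exists_simple_degenerate_of_extraspecial_table hdeg 0 0 0 0 x y x' y' hyx (by rw [show ((0 : ZMod 2)).val = 0 from rfl, pow_zero]; exact hxx) (by rw [show ((0 : ZMod 2)).val = 0 from rfl, pow_zero]; exact hyy)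
    hyx' (by rw [show ((0 : ZMod 2)).val = 0 from rfl, pow_zero]; exact hxx') (by rw [show ((0 : ZMod 2)).val = 0 from rfl, pow_zero]; exact hyy') hx'x hx'y hy'x hy'y
    (fun p q : ZMod 2 × ZMod 2 × ZMod 2 × ZMod 2 × ZMod 2 =>
      (p.1 + q.1, p.2.1 + q.2.1, p.2.2.1 + q.2.2.1, p.2.2.2.1 + q.2.2.2.1,
        p.2.2.2.2 + q.2.2.2.2 + (p.2.1 * q.1 + 0 * (p.1 * q.1) + 0 * (p.2.1 * q.2.1)) +
          (p.2.2.2.1 * q.2.2.1 + 0 * (p.2.2.1 * q.2.2.1) + 0 * (p.2.2.2.1 * q.2.2.2.1))))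
    (fun _ _ => rfl) (by decide) (by decide)
    {(0, 0, 0, 0, 0), (0, 0, 0, 1, 0), (0, 0, 1, 0, 1), (0, 0, 1, 1, 1), (0, 1, 0, 0, 1), (0, 1, 0, 1, 1),
    (0, 1, 1, 0, 0), (0, 1, 1, 1, 0), (1, 0, 0, 0, 1), (1, 0, 0, 1, 0), (1, 0, 1, 0, 1), (1, 0, 1, 1, 1),
    (1, 1, 0, 0, 0), (1, 1, 0, 1, 1), (1, 1, 1, 0, 0), (1, 1, 1, 1, 0)}
    (by decide) (by decide)
    {(0, 0, 0, 0, 0), (0, 0, 0, 1, 0), (0, 0, 1, 0, 0), (0, 1, 1, 1, 1)}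
    (by decide) (by decide)

set_option synthInstance.maxSize 4096 in
/-- **`Gal(K/ℚ) ⊇ ⟨x,y⟩ ∘ ⟨x',y'⟩` with `x² = y² = 1`, `x'² = y'² = c` (`[K:ℚ] = 32`: `Gal ≅ 2^{1+4}_- = D₄ ∘ Q₈`, census row #6) ⟹ a simple DEGENERATE CM abelian `16`-fold** (primitive CM set of rank `9 < 17`, balanced set of size `8`, by `decide`). [cite: Shimura1998, §6.2 Thm. 3 and §8.2 Prop. 26] [cite: Gordon1999HodgeAVSurvey, Thm. 6.4 and §9.3] -/
theorem exists_simple_degenerate_extraspecial_dq (hdeg : Module.finrank ℚ K = 32) (x y x' y' : K ≃ₐ[ℚ] K)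
    (hyx : y * x = x * y * (IsCMField.complexConj K).restrictScalars ℚ) (hxx : x * x = 1) (hyy : y * y = 1)
    (hyx' : y' * x' = x' * y' * (IsCMField.complexConj K).restrictScalars ℚ) (hxx' : x' * x' = (IsCMField.complexConj K).restrictScalars ℚ)
    (hyy' : y' * y' = (IsCMField.complexConj K).restrictScalars ℚ)
    (hx'x : x' * x = x * x') (hx'y : x' * y = y * x') (hy'x : y' * x = x * y') (hy'y : y' * y = y * y') :
    ∃ (Φ : CMType K) (φ : K →+* ℂ) (X : AbelianVariety ℂ) (ι : 𝓞 K →+* End X)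
      (ϑ : K →+* Module.End ℂ (complexBetti X.X 1)),
      IsPrimitive (ℂ ≃+* ℂ) Φ.1 φ ∧ ¬ IsNondegenerate Φ ∧ IsCMTypeRealisation Φ X ι ϑ ∧ X.IsSimple ∧ X.dim = 16 ∧
      ∃ m p : ℕ, ∃ z : complexBetti (⨁ fun _ : Fin m => X).X (2 * p), IsRationalClass z ∧
        IsOfHodgeType (⨁ fun _ : Fin m => X).dim (⨁ fun _ : Fin m => X).X (2 * p) p p z ∧
        z ∉ divisorClassesSpan (⨁ fun _ : Fin m => X).X (⨁ fun _ : Fin m => X).dim p :=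
  exists_simple_degenerate_of_extraspecial_table hdeg 0 0 1 1 x y x' y' hyx (by rw [show ((0 : ZMod 2)).val = 0 from rfl, pow_zero]; exact hxx) (by rw [show ((0 : ZMod 2)).val = 0 from rfl, pow_zero]; exact hyy)
    hyx' (by rw [show ((1 : ZMod 2)).val = 1 from rfl, pow_one]; exact hxx') (by rw [show ((1 : ZMod 2)).val = 1 from rfl, pow_one]; exact hyy') hx'x hx'y hy'x hy'y
    (fun p q : ZMod 2 × ZMod 2 × ZMod 2 × ZMod 2 × ZMod 2 =>
      (p.1 + q.1, p.2.1 + q.2.1, p.2.2.1 + q.2.2.1, p.2.2.2.1 + q.2.2.2.1,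
        p.2.2.2.2 + q.2.2.2.2 + (p.2.1 * q.1 + 0 * (p.1 * q.1) + 0 * (p.2.1 * q.2.1)) +
          (p.2.2.2.1 * q.2.2.1 + 1 * (p.2.2.1 * q.2.2.1) + 1 * (p.2.2.2.1 * q.2.2.2.1))))
    (fun _ _ => rfl) (by decide) (by decide)
    {(0, 0, 0, 0, 0), (0, 0, 0, 1, 1), (0, 0, 1, 0, 1), (0, 0, 1, 1, 0), (0, 1, 0, 0, 1), (0, 1, 0, 1, 0),
    (0, 1, 1, 0, 0), (0, 1, 1, 1, 1), (1, 0, 0, 0, 0), (1, 0, 0, 1, 1), (1, 0, 1, 0, 1), (1, 0, 1, 1, 1),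
    (1, 1, 0, 0, 1), (1, 1, 0, 1, 0), (1, 1, 1, 0, 0), (1, 1, 1, 1, 0)}
    (by decide) (by decide)
    {(0, 0, 0, 0, 0), (0, 0, 0, 1, 0), (0, 0, 1, 0, 0), (0, 1, 1, 1, 0), (1, 0, 0, 1, 1), (1, 0, 1, 0, 1),
    (1, 1, 0, 1, 1), (1, 1, 1, 0, 0)}
    (by decide) (by decide)

set_option synthInstance.maxSize 4096 in
/-- **`Gal(K/ℚ) ⊇ ⟨x,y⟩ ∘ ⟨x',y'⟩` with `x² = y² = x'² = y'² = c` (`[K:ℚ] = 32`: `Gal ≅ Q₈ ∘ Q₈ ≅ 2^{1+4}_+`, census row #5) ⟹ a simple DEGENERATE CM abelian `16`-fold** (primitive CM set of rank `13 < 17`, balanced set of size `4`, by `decide`). [cite: Shimura1998, §6.2 Thm. 3 and §8.2 Prop. 26] [cite: Gordon1999HodgeAVSurvey, Thm. 6.4 and §9.3] -/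
theorem exists_simple_degenerate_extraspecial_qq (hdeg : Module.finrank ℚ K = 32) (x y x' y' : K ≃ₐ[ℚ] K)
    (hyx : y * x = x * y * (IsCMField.complexConj K).restrictScalars ℚ) (hxx : x * x = (IsCMField.complexConj K).restrictScalars ℚ) (hyy : y * y = (IsCMField.complexConj K).restrictScalars ℚ)
    (hyx' : y' * x' = x' * y' * (IsCMField.complexConj K).restrictScalars ℚ) (hxx' : x' * x' = (IsCMField.complexConj K).restrictScalars ℚ)
    (hyy' : y' * y' = (IsCMField.complexConj K).restrictScalars ℚ)
    (hx'x : x' * x = x * x') (hx'y : x' * y = y * x') (hy'x : y' * x = x * y') (hy'y : y' * y = y * y') :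
    ∃ (Φ : CMType K) (φ : K →+* ℂ) (X : AbelianVariety ℂ) (ι : 𝓞 K →+* End X)
      (ϑ : K →+* Module.End ℂ (complexBetti X.X 1)),
      IsPrimitive (ℂ ≃+* ℂ) Φ.1 φ ∧ ¬ IsNondegenerate Φ ∧ IsCMTypeRealisation Φ X ι ϑ ∧ X.IsSimple ∧ X.dim = 16 ∧
      ∃ m p : ℕ, ∃ z : complexBetti (⨁ fun _ : Fin m => X).X (2 * p), IsRationalClass z ∧
        IsOfHodgeType (⨁ fun _ : Fin m => X).dim (⨁ fun _ : Fin m => X).X (2 * p) p p z ∧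
        z ∉ divisorClassesSpan (⨁ fun _ : Fin m => X).X (⨁ fun _ : Fin m => X).dim p :=
  exists_simple_degenerate_of_extraspecial_table hdeg 1 1 1 1 x y x' y' hyx (by rw [show ((1 : ZMod 2)).val = 1 from rfl, pow_one]; exact hxx) (by rw [show ((1 : ZMod 2)).val = 1 from rfl, pow_one]; exact hyy)
    hyx' (by rw [show ((1 : ZMod 2)).val = 1 from rfl, pow_one]; exact hxx') (by rw [show ((1 : ZMod 2)).val = 1 from rfl, pow_one]; exact hyy') hx'x hx'y hy'x hy'y
    (fun p q : ZMod 2 × ZMod 2 × ZMod 2 × ZMod 2 × ZMod 2 =>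
      (p.1 + q.1, p.2.1 + q.2.1, p.2.2.1 + q.2.2.1, p.2.2.2.1 + q.2.2.2.1,
        p.2.2.2.2 + q.2.2.2.2 + (p.2.1 * q.1 + 1 * (p.1 * q.1) + 1 * (p.2.1 * q.2.1)) +
          (p.2.2.2.1 * q.2.2.1 + 1 * (p.2.2.1 * q.2.2.1) + 1 * (p.2.2.2.1 * q.2.2.2.1))))
    (fun _ _ => rfl) (by decide) (by decide)
    {(0, 0, 0, 0, 0), (0, 0, 0, 1, 0), (0, 0, 1, 0, 1), (0, 0, 1, 1, 0), (0, 1, 0, 0, 0), (0, 1, 0, 1, 1),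
    (0, 1, 1, 0, 0), (0, 1, 1, 1, 1), (1, 0, 0, 0, 0), (1, 0, 0, 1, 0), (1, 0, 1, 0, 1), (1, 0, 1, 1, 0),
    (1, 1, 0, 0, 1), (1, 1, 0, 1, 0), (1, 1, 1, 0, 0), (1, 1, 1, 1, 1)}
    (by decide) (by decide)
    {(0, 0, 0, 0, 0), (0, 1, 1, 0, 1), (1, 0, 0, 1, 0), (1, 1, 1, 1, 0)}
    (by decide) (by decide)

/-! ## §2 The theorem -/

/-- **A Galois CM field of degree `32` with `g² ∈ {1, c}` for all `g ∈ Gal(K/ℚ)` (i.e. `K⁺` multiquadratic) carries a simple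
DEGENERATE abelian `16`-fold with CM by `K`** — an exceptional Hodge class (rational, `(p,p)`, outside the divisor ring) on some
power.  Abelian `Gal`: gens 15–16; `C_G(x)` abelian for a non-commuting pair: gen 35's two-cyclic criterion with a central involution
`t ≠ c` and a third involution; `C_G(x)` non-abelian: the extraspecial certificates of §1.
[cite: Shimura1998, §6.2 Thm. 3 and §8.2 Prop. 26] [cite: Kubota1965, §2 and §4 Lemma 2] [cite: Gordon1999HodgeAVSurvey, Thm. 6.4, §9.3 and §9.4.3]
[cite: Dodson1984, §3.3 and §5.3] -/
theorem exists_simple_degenerate_of_sq_subset (hdeg : Module.finrank ℚ K = 32)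
    (hsq : ∀ g : K ≃ₐ[ℚ] K, g * g = 1 ∨ g * g = (IsCMField.complexConj K).restrictScalars ℚ) :
    ∃ (Φ : CMType K) (φ : K →+* ℂ) (X : AbelianVariety ℂ) (ι : 𝓞 K →+* End X)
      (ϑ : K →+* Module.End ℂ (complexBetti X.X 1)),
      IsPrimitive (ℂ ≃+* ℂ) Φ.1 φ ∧ ¬ IsNondegenerate Φ ∧ IsCMTypeRealisation Φ X ι ϑ ∧ X.IsSimple ∧ X.dim = 16 ∧
      ∃ m p : ℕ, ∃ z : complexBetti (⨁ fun _ : Fin m => X).X (2 * p), IsRationalClass z ∧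
        IsOfHodgeType (⨁ fun _ : Fin m => X).dim (⨁ fun _ : Fin m => X).X (2 * p) p p z ∧
        z ∉ divisorClassesSpan (⨁ fun _ : Fin m => X).X (⨁ fun _ : Fin m => X).dim p := by
  classical
  set c := (IsCMField.complexConj K).restrictScalars ℚ with hc
  have hcc : c * c = 1 := model_complexConj_mul_self (MulEquiv.refl (K ≃ₐ[ℚ] K)) (by simp [hc])
  have hc1 : c ≠ 1 := model_complexConj_ne_one (MulEquiv.refl (K ≃ₐ[ℚ] K)) (by simp [hc])
  have hcen : ∀ g : K ≃ₐ[ℚ] K, c * g = g * c := fun g =>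
    model_complexConj_comm (MulEquiv.refl (K ≃ₐ[ℚ] K)) (by simp [hc]) g
  have hcardF : Fintype.card (K ≃ₐ[ℚ] K) = 32 := by rw [card_model_eq_finrank (MulEquiv.refl (K ≃ₐ[ℚ] K)), hdeg]
  have hcard : Nat.card (K ≃ₐ[ℚ] K) = 32 := by rw [Nat.card_eq_fintype_card, hcardF]
  have h20 : 20 ≤ Nat.card (K ≃ₐ[ℚ] K) := by rw [hcard]; norm_num
  have hdeg5 : Module.finrank ℚ K = 2 ^ 5 := by rw [hdeg]; norm_num
  by_cases hab : ∀ g h : K ≃ₐ[ℚ] K, g * h = h * g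
  · /- ABELIAN: no cyclic subgroup of index `≤ 2` (exponent `≤ 4`) -/
    have hα : ¬ ∃ z : K ≃ₐ[ℚ] K, c ∈ Subgroup.zpowers z ∧ (Subgroup.zpowers z).index ≤ 2 := by
      rintro ⟨z, -, hidx⟩
      have hz4 : z ^ 4 = 1 := by
        rw [show z ^ 4 = (z * z) * (z * z) by simp only [pow_succ, pow_zero, one_mul, mul_assoc]]
        rcases hsq z with h | h <;> rw [h]
        · exact one_mul 1
        · exact hcc
      have hoz : orderOf z ≤ 4 := Nat.le_of_dvd (by norm_num) (orderOf_dvd_of_pow_eq_one hz4)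
      have h1 := (Subgroup.zpowers z).card_mul_index
      rw [Nat.card_zpowers, hcard] at h1
      have : (Subgroup.zpowers z).index ≤ 2 := hidx
      nlinarith [hoz, this, orderOf_pos z]
    obtain ⟨Φ, φ, X, ι, ϑ, H1, H2, H3, H4, H5, H6⟩ :=
      AbelianTwoPowerClassification.exists_simple_degenerate_of_not_thin_of_le_finrank hab
        (show Module.finrank ℚ K = 2 ^ (4 + 1) by rw [hdeg]; norm_num) (by rw [hdeg]) hα
    exact ⟨Φ, φ, X, ι, ϑ, H1, H2, H3, H4, by rw [H5]; norm_num, H6⟩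
  · push Not at hab
    obtain ⟨y, x, hne⟩ := hab
    have hyx : y * x = x * y * c := comm_mul_of_ne hcc hcen hsq hne
    set A := Subgroup.centralizer ({x} : Set (K ≃ₐ[ℚ] K)) with hA
    have hAidx : A.index = 2 := index_centralizer_eq_two hcc hc1 hcen hsq hyx
    have hmemA : ∀ g : K ≃ₐ[ℚ] K, g ∈ A ↔ g * x = x * g := fun g => Subgroup.mem_centralizer_singleton_iff
    by_cases hAab : ∀ g ∈ A, ∀ h ∈ A, g * h = h * g
    · /- `C_G(x)` ABELIAN: the two-cyclic criterion with a central `t ≠ c` and a third involution `u` -/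
      obtain ⟨t, htt, ht1, htc, htcen, htx, -⟩ := exists_central_involution_ne hcc hc1 hcen hsq hyx hAab h20
      obtain ⟨u, huu, hux, hu1, huc, hut, huct⟩ := exists_third_involution hcc hc1 hcen hsq hyx h20 ht1 htc htcen
      have hmemt : ∀ σ : K ≃ₐ[ℚ] K, σ ∈ Subgroup.zpowers t ↔ σ = 1 ∨ σ = t := mem_zpowers_iff_of_mul_self_eq_one htt
      have hmemu : ∀ σ : K ≃ₐ[ℚ] K, σ ∈ Subgroup.zpowers u ↔ σ = 1 ∨ σ = u := mem_zpowers_iff_of_mul_self_eq_one huu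
      have hot : orderOf t = 2 := orderOf_eq_prime (by rw [pow_two, htt]) ht1
      have hou : orderOf u = 2 := orderOf_eq_prime (by rw [pow_two, huu]) hu1
      obtain ⟨Φ, φ, X, ι, ϑ, H1, H2, H3, H4, H5, H6⟩ := exists_simple_degenerate_of_index_two_pair hdeg5 (by norm_num) A hAidx
        hAab ((hmemA c).2 (hcen x)) t u ((hmemA t).2 htx) ((hmemA u).2 hux)
        (fun h => ((hmemt c).1 h).elim (fun h => hc1 h) (fun h => htc h.symm))
        (fun h => ((hmemu c).1 h).elim (fun h => hc1 h) (fun h => huc h.symm)) ht1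
        (fun h => by
          rcases (SkewSection.mem_closure_pair_iff hcc htt (hcen t) u).1 h with h | h | h | h
          · exact hu1 h
          · exact hut h
          · exact huc h
          · exact huct h)
        (fun w hwt hwu => by
          rcases (hmemt w).1 hwt with h | h
          · exact h
          · rcases (hmemu w).1 hwu with h' | h'
            · exact h'
            · exact absurd (h.symm.trans h') hut.symm)
        (fun g h => by
          have hgt : g * t * g⁻¹ = t := by rw [mul_assoc, htcen, ← mul_assoc]; simp
          rw [hgt] at h
          rcases (hmemu t).1 h with h | h
          · exact ht1 h
          · exact hut h.symm)
        (by rw [hot]; norm_num) (by rw [hou]; norm_num)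
      exact ⟨Φ, φ, X, ι, ϑ, H1, H2, H3, H4, by rw [H5, hcardF], H6⟩
    · /- `C_G(x)` NON-ABELIAN: the extraspecial configuration -/
      push Not at hAab
      obtain ⟨g, hg, h, hh, hgh⟩ := hAab
      obtain ⟨x', y', hx'x, hx'y, hy'x, hy'y, hyx'⟩ :=
        exists_noncomm_pair_centralizing hcc hcen hsq hyx ⟨g, hg, h, hh, hgh⟩
      -- normalise both pairs to dihedral / quaternion shape
      obtain ⟨x₁, y₁, hyx₁, hsq₁, hcomm₁⟩ := exists_noncomm_pair_normalised hcc hcen hsq hyx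
      obtain ⟨h11, h12⟩ := hcomm₁ x' hx'x hx'y
      obtain ⟨h13, h14⟩ := hcomm₁ y' hy'x hy'y
      obtain ⟨x₂, y₂, hyx₂, hsq₂, hcomm₂⟩ := exists_noncomm_pair_normalised hcc hcen hsq hyx'
      obtain ⟨h21, h22⟩ := hcomm₂ x₁ h11.symm h13.symm
      obtain ⟨h23, h24⟩ := hcomm₂ y₁ h12.symm h14.symm
      -- `x₂, y₂` commute with `x₁, y₁`
      rcases hsq₁ with ⟨hx₁, hy₁⟩ | ⟨hx₁, hy₁⟩ <;> rcases hsq₂ with ⟨hx₂, hy₂⟩ | ⟨hx₂, hy₂⟩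
      · exact exists_simple_degenerate_extraspecial_dd hdeg x₁ y₁ x₂ y₂ hyx₁ hx₁ hy₁ hyx₂ hx₂ hy₂
          h21.symm h23.symm h22.symm h24.symm
      · exact exists_simple_degenerate_extraspecial_dq hdeg x₁ y₁ x₂ y₂ hyx₁ hx₁ hy₁ hyx₂ hx₂ hy₂
          h21.symm h23.symm h22.symm h24.symm
      · exact exists_simple_degenerate_extraspecial_dq hdeg x₂ y₂ x₁ y₁ hyx₂ hx₂ hy₂ hyx₁ hx₁ hy₁ h21 h22 h23 h24
      · exact exists_simple_degenerate_extraspecial_qq hdeg x₁ y₁ x₂ y₂ hyx₁ hx₁ hy₁ hyx₂ hx₂ hy₂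
          h21.symm h23.symm h22.symm h24.symm

end Summit.HodgeConjecture.CorCM.GaloisModels

end
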